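import Literature.NumberTheory.Sieve.HeathBrownCubicTwistedDefs
import HarnessLib

/-!
# Heath-Brown's Lemma 3.10 for a twisted weight: §13 pp. 81–82, the small moduli via (3.14) at level `d·Q₁`

D. R. Heath-Brown, *Primes represented by `x³ + 2y³`*, Acta Math. 186 (2001), §13 (13.5)–(13.6), for the
twisted weight `F'_β(w) = w(β̂) f_(β)[β̂ primitive]` with `w : ℤ³ → ℝ` `d`-PERIODIC and `|w| ≤ 1` — the
one genuinely new arithmetic step of the residue-class Type II estimate (Heath-Brown–Moroz, Proc. LMS 88
(2004), Prop. 4.2 (ii), p. 23: "we decompose the sum according to the residue classes of `β₁, β₂` modulo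
`d` … providing that `[q, d] ≤ Q₁`"). A class `{β̂ ∈ C : g ∣ β̂, β̂ ≡ c (mod q)}` twisted by a `d`-periodic
`w` splits into the `d³` classes `β̂ ≡ r (mod d)`, each empty or ONE class modulo `lcm(lcm(g,q), d) ≤ gqd`,
where hypothesis (3.14) at level `d·Q₁` applies. PROVED: `Sfrac_Fprim_eq_sum_moebius` (Möbius over
`g ∣ β̂`, twisted), `norm_Ag_le` (`|A_g(w)| ≤ q³ d³ · C₁Ve^{−c₁√log L}` for `gq ≤ Q₁` under
`Hyp314 … (d·Q₁)`), `norm_Sfrac_Fprim_le` (the small-`q` bound with `C₁ ↦ d³C₁`), `abs_Fprim_le`.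

## References

* D. R. Heath-Brown, Acta Math. 186 (2001), §13 pp. 81–82. [cite: HeathBrownActa2001, §13 pp. 81–82]
* D. R. Heath-Brown, B. Z. Moroz, Proc. London Math. Soc. 88 (2004), Prop. 4.2 (ii), p. 23.
  [cite: HeathBrownMoroz2004, Proposition 4.2]

## Mathlib / tree search

Tree: `HeathBrownCubicTypeIISmallQ` (`Fprim`, `Ag`, `filter_dvd_red_eq`, `sum_filter_lcm_eq_swSum`,
`norm_Ag_le`, `sum_filter_dvd_tau_le`, `norm_Sfrac_Fprim_le`), `HeathBrownCubicTypeIICharSum` (`Sfrac`,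
`resVecs`, `redVec`), `HeathBrownCubicTypeII` (`Hyp314`, `swSum`).
-/

noncomputable section

open Finset NumberField

open scoped ArithmeticFunction.Moebius

namespace Literature.NumberTheory.Sieve.CubicSieve.Twisted

open LFunctions.CubeRootTwoField CubicPrimes CubicSieve LargeSieve

variable {X τ : ℝ} {k : ℕ} {m : Fin k → ℕ} {w : ℤ × ℤ × ℤ → ℝ}

/-- `F'(w) ≠ 0 ⇒ β̂` primitive. [cite: HeathBrownActa2001, §13 p. 82] -/
theorem prim_of_Fprim_ne_zero {v : ℤ × ℤ × ℤ} (h : Fprim X τ m w v ≠ 0) : IsPrimitiveVec v := by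
  by_contra hp; exact h (by rw [Fprim_def, CubicSieve.Fprim, if_neg hp, mul_zero])

/-- `|F'_β(w)| ≤ |F'_β|` for `|w| ≤ 1`. [cite: HeathBrownMoroz2004, Proposition 4.2] -/
theorem abs_Fprim_le_abs (hw : ∀ b, |w b| ≤ 1) (v : ℤ × ℤ × ℤ) :
    |Fprim X τ m w v| ≤ |CubicSieve.Fprim X τ m v| := by
  rw [Fprim_def, abs_mul]
  exact (mul_le_mul_of_nonneg_right (hw v) (abs_nonneg _)).trans_eq (one_mul _)

/-- `|F'_β(w)| ≤ 9 τ(β)`. [cite: HeathBrownActa2001, §13 p. 82] -/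
theorem abs_Fprim_le (hw : ∀ b, |w b| ≤ 1) (hX : 1 < X) (hτ : 0 < τ) (hτ1 : τ ≤ 1) {nn : ℕ}
    {m : Fin (nn + 1) → ℕ} (hm : CoreAdmissible τ m) (v : ℤ × ℤ × ℤ) : |Fprim X τ m w v| ≤ 9 * tauK v :=
  (abs_Fprim_le_abs hw v).trans (CubicSieve.abs_Fprim_le hX hτ hτ1 hm v)

/-- `F'(w)² ≤ F'²` for `|w| ≤ 1`. [cite: HeathBrownMoroz2004, Proposition 4.2] -/
theorem Fprim_sq_le_sq (hw : ∀ b, |w b| ≤ 1) (v : ℤ × ℤ × ℤ) :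
    Fprim X τ m w v ^ 2 ≤ CubicSieve.Fprim X τ m v ^ 2 := by
  rw [← sq_abs, ← sq_abs (CubicSieve.Fprim X τ m v)]
  exact pow_le_pow_left₀ (abs_nonneg _) (abs_Fprim_le_abs hw v) 2

open scoped Classical in
/-- **Möbius over `g ∣ β̂`**, twisted: `S(b/q; C; F'(w)) = ∑_{g ≤ M} μ(g) A_g(w)` when every `β̂ ∈ C` is
nonzero with `h.c.f.(β̂) ≤ M`. [cite: HeathBrownActa2001, §13 (13.6)] -/
theorem Sfrac_Fprim_eq_sum_moebius {C : Finset (ℤ × ℤ × ℤ)} (hC0 : ∀ v ∈ C, v ≠ 0) {M : ℕ}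
    (hM : ∀ v ∈ C, hcf3 v ≤ M) (q : ℕ) (b : ℤ × ℤ × ℤ) :
    Sfrac (Fprim X τ m w) C q b = ∑ g ∈ Icc 1 M, (μ g : ℂ) * Ag X τ m w C q b g := by
  classical
  have hF : ∀ v ∈ C, (Fprim X τ m w v : ℂ) =
      (∑ g ∈ (Icc 1 M).filter (fun g : ℕ => DvdVec (g : ℤ) v), (μ g : ℂ)) *
        ((w v * fWeight X τ m (Ideal.span {coordElt v}) : ℝ) : ℂ) := by
    intro v hv
    have hdiv : (hcf3 v).divisors = (Icc 1 M).filter (fun g : ℕ => DvdVec (g : ℤ) v) := by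
      ext g
      rw [Nat.mem_divisors, mem_filter, mem_Icc, ← natCast_dvd_hcf3_iff]
      have h0 : hcf3 v ≠ 0 := fun h => hC0 v hv ((hcf3_eq_zero_iff v).mp h)
      constructor
      · rintro ⟨hd, -⟩
        exact ⟨⟨Nat.pos_of_dvd_of_pos hd (Nat.pos_of_ne_zero h0),
          (Nat.le_of_dvd (Nat.pos_of_ne_zero h0) hd).trans (hM v hv)⟩, hd⟩
      · rintro ⟨-, hd⟩; exact ⟨hd, h0⟩
    have hind := indicator_prim_eq_sum_moebius v
    rw [hdiv] at hind
    rw [Fprim_def, CubicSieve.Fprim]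
    split_ifs with hp
    · rw [if_pos hp] at hind
      have : (∑ g ∈ (Icc 1 M).filter (fun g : ℕ => DvdVec (g : ℤ) v), (μ g : ℂ)) = 1 := by
        have h := congrArg (fun x : ℝ => (x : ℂ)) hind
        push_cast at h
        exact h.symm
      rw [this, one_mul]
    · rw [if_neg hp] at hind
      have : (∑ g ∈ (Icc 1 M).filter (fun g : ℕ => DvdVec (g : ℤ) v), (μ g : ℂ)) = 0 := by
        have h := congrArg (fun x : ℝ => (x : ℂ)) hind
        push_cast at h
        exact h.symm
      rw [this, zero_mul]; simp
  calc Sfrac (Fprim X τ m w) C q b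
      = ∑ v ∈ C, (∑ g ∈ (Icc 1 M).filter (fun g : ℕ => DvdVec (g : ℤ) v), (μ g : ℂ)) *
          (((w v * fWeight X τ m (Ideal.span {coordElt v}) : ℝ) : ℂ) * LargeSieve.e ((dot3 b v : ℤ) / (q : ℝ))) := by
        rw [Sfrac]
        refine sum_congr rfl fun v hv => ?_
        rw [hF v hv]; ring
    _ = ∑ v ∈ C, ∑ g ∈ Icc 1 M, (if DvdVec (g : ℤ) v then (μ g : ℂ) *
          (((w v * fWeight X τ m (Ideal.span {coordElt v}) : ℝ) : ℂ) * LargeSieve.e ((dot3 b v : ℤ) / (q : ℝ)))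
          else 0) := by
        refine sum_congr rfl fun v _ => ?_
        rw [sum_filter, sum_mul]
        refine sum_congr rfl fun g _ => ?_
        split_ifs <;> simp
    _ = ∑ g ∈ Icc 1 M, ∑ v ∈ C, (if DvdVec (g : ℤ) v then (μ g : ℂ) *
          (((w v * fWeight X τ m (Ideal.span {coordElt v}) : ℝ) : ℂ) * LargeSieve.e ((dot3 b v : ℤ) / (q : ℝ)))
          else 0) := Finset.sum_comm
    _ = ∑ g ∈ Icc 1 M, (μ g : ℂ) * Ag X τ m w C q b g := by
        refine sum_congr rfl fun g _ => ?_
        rw [Ag, sum_filter, mul_sum]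
        refine sum_congr rfl fun v _ => ?_
        split_ifs <;> simp

/-- A `d`-periodic twist depends only on the reduction mod `d`: `w(v) = w(red_d v)`. [cite: HeathBrownMoroz2004, Proposition 4.2] -/
theorem w_eq_w_redVec {d : ℕ} (hwper : ∀ b u, DvdVec (d : ℤ) u → w (b + u) = w b) (v : ℤ × ℤ × ℤ) :
    w v = w (redVec d v) := by
  have h := hwper (redVec d v) (v - redVec d v) (dvdVec_sub_redVec d v)
  rw [add_sub_cancel] at h
  exact h

/-- `lcm(lcm(g,q), d) ≤ g q d` for positive `g, q, d`. [cite: HeathBrownMoroz2004, Proposition 4.2] -/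
theorem lcm_lcm_le {g q d : ℕ} (hg : 1 ≤ g) (hq : 1 ≤ q) (hd : 1 ≤ d) :
    Nat.lcm (Nat.lcm g q) d ≤ g * q * d := by
  have h1 : Nat.lcm g q ≤ g * q := Nat.lcm_le_mul (by omega) (by omega)
  have h0 : 0 < Nat.lcm g q := Nat.pos_of_ne_zero (Nat.lcm_ne_zero (by omega) (by omega))
  exact (Nat.lcm_le_mul (by omega) (by omega)).trans (Nat.mul_le_mul_right _ h1)

open scoped Classical in
/-- **One residue class modulo `[[g, q], d]`**: if `v₀ ∈ C` has `g ∣ v₀`, then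
`{β̂ ∈ C : g ∣ β̂, red_q β̂ = red_q v₀, red_d β̂ = red_d v₀} = {β̂ ∈ C : lcm(lcm(g,q),d) ∣ β̂ − v₀}`
(HBM04 p. 23: the class condition and `β̂ ≡ c (mod q)`, `g ∣ β̂` "confine `β̂` to a single residue class").
[cite: HeathBrownMoroz2004, Proposition 4.2] -/
theorem filter_dvd_red_red_eq {C : Finset (ℤ × ℤ × ℤ)} {g q d : ℕ} (hq : 0 < q) {v₀ : ℤ × ℤ × ℤ}
    (hg0 : DvdVec (g : ℤ) v₀) :
    C.filter (fun v => DvdVec (g : ℤ) v ∧ redVec q v = redVec q v₀ ∧ redVec d v = redVec d v₀) =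
      C.filter (fun v => DvdVec ((Nat.lcm (Nat.lcm g q) d : ℕ) : ℤ) (v - v₀)) := by
  classical
  have hsplit : C.filter (fun v => DvdVec (g : ℤ) v ∧ redVec q v = redVec q v₀ ∧ redVec d v = redVec d v₀) =
      (C.filter (fun v => DvdVec (g : ℤ) v ∧ redVec q v = redVec q v₀)).filter
        (fun v => redVec d v = redVec d v₀) := by
    rw [filter_filter]; simp only [and_assoc]
  rw [hsplit, filter_dvd_red_eq hq hg0, filter_filter]
  refine filter_congr fun v _ => ?_
  set ℓ : ℕ := Nat.lcm g q with hℓ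
  constructor
  · rintro ⟨hl, hred⟩
    have hdd : DvdVec (d : ℤ) (v - v₀) := by
      have h1 := dvdVec_sub_redVec d v
      have h2 := dvdVec_sub_redVec d v₀
      rw [hred] at h1
      have e1 : v - v₀ = (v - redVec d v₀) + -(v₀ - redVec d v₀) := by abel
      rw [e1]; exact dvdVec_add h1 (dvdVec_neg h2)
    exact ⟨natLcm_dvd_of_dvd hl.1 hdd.1, natLcm_dvd_of_dvd hl.2.1 hdd.2.1, natLcm_dvd_of_dvd hl.2.2 hdd.2.2⟩
  · intro hL
    have hℓL : (ℓ : ℤ) ∣ ((Nat.lcm ℓ d : ℕ) : ℤ) := by exact_mod_cast Nat.dvd_lcm_left ℓ d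
    have hdL : (d : ℤ) ∣ ((Nat.lcm ℓ d : ℕ) : ℤ) := by exact_mod_cast Nat.dvd_lcm_right ℓ d
    have hl : DvdVec (ℓ : ℤ) (v - v₀) := ⟨hℓL.trans hL.1, hℓL.trans hL.2.1, hℓL.trans hL.2.2⟩
    have hdd : DvdVec (d : ℤ) (v - v₀) := ⟨hdL.trans hL.1, hdL.trans hL.2.1, hdL.trans hL.2.2⟩
    refine ⟨hl, ?_⟩
    -- `red_d v = red_d v₀` from `d ∣ v − v₀`
    by_cases hd : d = 0
    · subst hd
      obtain ⟨h1, h2, h3⟩ := hdd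
      simp only [Nat.cast_zero, zero_dvd_iff, Prod.fst_sub, Prod.snd_sub, sub_eq_zero] at h1 h2 h3
      have : v = v₀ := Prod.ext h1 (Prod.ext h2 h3)
      rw [this]
    refine eq_of_dvdVec_sub (redVec_mem (Nat.pos_of_ne_zero hd) v) (redVec_mem (Nat.pos_of_ne_zero hd) v₀) ?_
    have h1 := dvdVec_sub_redVec d v
    have h2 := dvdVec_sub_redVec d v₀
    have e1 : redVec d v - redVec d v₀ = -(v - redVec d v) + (v - v₀) + (v₀ - redVec d v₀) := by abel
    rw [e1]; exact dvdVec_add (dvdVec_add (dvdVec_neg h1) hdd) h2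

open scoped Classical in
/-- **`|A_g(w)| ≤ q³ d³ · C₁ V e^{−c₁√(log L)}`** for `1 ≤ g`, `gq ≤ Q₁`, `w` `d`-periodic with `|w| ≤ 1`, on
a cube satisfying the conditions of (3.14), under (3.14) up to `d·Q₁` (each class mod `q` with `g ∣ β̂`
splits into `d³` classes mod `d`, each one class modulo `lcm(lcm(g,q),d) ≤ gqd ≤ dQ₁`).
[cite: HeathBrownMoroz2004, Proposition 4.2] -/
theorem norm_Ag_le {Q₁ C₁ c₁ c₃ c₄ : ℝ} {d : ℕ} (hd : 0 < d)
    (hHyp : Hyp314 X τ m ((d : ℝ) * Q₁) C₁ c₁ c₃ c₄) (hw1 : ∀ b, |w b| ≤ 1)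
    (hwper : ∀ b u, DvdVec (d : ℤ) u → w (b + u) = w b) {V : ℝ} (hV : 0 < V)
    {a : ℝ × ℝ × ℝ} {S₀ : ℝ} (hs : hbL X τ ^ 2 ≤ S₀) (hcube : CubeCond c₃ c₄ V a S₀)
    {q : ℕ} (hq : 1 ≤ q) {g : ℕ} (hg : 1 ≤ g) (hgq : ((g * q : ℕ) : ℝ) ≤ Q₁) (b : ℤ × ℤ × ℤ) :
    ‖Ag X τ m w (latticeCube a S₀) q b g‖ ≤
      (q : ℝ) ^ 3 * ((d : ℝ) ^ 3 * (C₁ * V * Real.exp (-(c₁ * Real.sqrt (Real.log (hbL X τ)))))) := by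
  classical
  set C := latticeCube a S₀ with hC
  set H : ℝ := C₁ * V * Real.exp (-(c₁ * Real.sqrt (Real.log (hbL X τ)))) with hH
  set ℓ : ℕ := Nat.lcm (Nat.lcm g q) d with hℓ
  have hqpos : 0 < q := by omega
  have hdR : (1 : ℝ) ≤ d := by exact_mod_cast hd
  have hℓ1 : 1 ≤ ℓ := Nat.pos_of_ne_zero (Nat.lcm_ne_zero (Nat.lcm_ne_zero (by omega) (by omega)) (by omega))
  have hℓQ : (ℓ : ℝ) ≤ (d : ℝ) * Q₁ := by
    have h1 : (ℓ : ℝ) ≤ ((g * q * d : ℕ) : ℝ) := by exact_mod_cast lcm_lcm_le hg hq hd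
    calc (ℓ : ℝ) ≤ ((g * q * d : ℕ) : ℝ) := h1
      _ = (d : ℝ) * ((g * q : ℕ) : ℝ) := by push_cast; ring
      _ ≤ (d : ℝ) * Q₁ := mul_le_mul_of_nonneg_left hgq (by positivity)
  have hH0 : 0 ≤ H := by
    have := hHyp ℓ hℓ1 hℓQ 0 V a S₀ hV hs hcube
    exact (abs_nonneg _).trans this
  -- group by the residue `c = red_q(v)`
  have hphase : ∀ v : ℤ × ℤ × ℤ, LargeSieve.e ((dot3 b v : ℤ) / (q : ℝ)) =
      LargeSieve.e ((dot3 b (redVec q v) : ℤ) / (q : ℝ)) := by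
    intro v
    obtain ⟨⟨k1, hk1⟩, ⟨k2, hk2⟩, ⟨k3, hk3⟩⟩ := dvdVec_sub_redVec q v
    simp only [Prod.fst_sub, Prod.snd_sub] at hk1 hk2 hk3
    have : dot3 b v = dot3 b (redVec q v) + (q : ℤ) * (b.1 * k1 + b.2.1 * k2 + b.2.2 * k3) := by
      simp only [dot3]; linear_combination b.1 * hk1 + b.2.1 * hk2 + b.2.2 * hk3
    rw [this, Int.cast_add, add_div]
    have hq0 : (q : ℝ) ≠ 0 := by exact_mod_cast hqpos.ne'
    have : (((q : ℤ) * (b.1 * k1 + b.2.1 * k2 + b.2.2 * k3) : ℤ) : ℝ) / q =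
        ((b.1 * k1 + b.2.1 * k2 + b.2.2 * k3 : ℤ) : ℝ) := by push_cast; field_simp
    rw [this, e_add_int]
  set A := C.filter (fun v => DvdVec (g : ℤ) v) with hA
  have hmaps : ∀ v ∈ A, redVec q v ∈ resVecs q := fun v _ => redVec_mem hqpos v
  set f : ℤ × ℤ × ℤ → ℝ := fun v => fWeight X τ m (Ideal.span {coordElt v}) with hf
  have hsplit : Ag X τ m w C q b g = ∑ c ∈ resVecs q, LargeSieve.e ((dot3 b c : ℤ) / (q : ℝ)) *
      ∑ v ∈ A.filter (fun v => redVec q v = c), ((w v * f v : ℝ) : ℂ) := by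
    rw [Ag, ← hA, ← sum_fiberwise_of_maps_to hmaps]
    refine sum_congr rfl fun c _ => ?_
    rw [mul_sum]
    refine sum_congr rfl fun v hv => ?_
    rw [mem_filter] at hv
    rw [hphase v, hv.2]; ring
  -- each class mod `q` splits into `d³` classes mod `d`, each a `swSum` with modulus `ℓ ≤ dQ₁`, or empty
  have hinner : ∀ c ∈ resVecs q, ‖∑ v ∈ A.filter (fun v => redVec q v = c), ((w v * f v : ℝ) : ℂ)‖ ≤
      (d : ℝ) ^ 3 * H := by
    intro c _
    set Ac := A.filter (fun v => redVec q v = c) with hAc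
    have hmaps' : ∀ v ∈ Ac, redVec d v ∈ resVecs d := fun v _ => redVec_mem hd v
    have hsplit' : ∑ v ∈ Ac, ((w v * f v : ℝ) : ℂ) =
        ∑ r ∈ resVecs d, ((w r : ℝ) : ℂ) * ∑ v ∈ Ac.filter (fun v => redVec d v = r), ((f v : ℝ) : ℂ) := by
      rw [← sum_fiberwise_of_maps_to hmaps']
      refine sum_congr rfl fun r _ => ?_
      rw [mul_sum]
      refine sum_congr rfl fun v hv => ?_
      rw [mem_filter] at hv
      rw [w_eq_w_redVec hwper v, hv.2]; push_cast; ring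
    have hclass : ∀ r ∈ resVecs d, ‖∑ v ∈ Ac.filter (fun v => redVec d v = r), ((f v : ℝ) : ℂ)‖ ≤ H := by
      intro r _
      by_cases hempty : Ac.filter (fun v => redVec d v = r) = ∅
      · rw [hempty, sum_empty, norm_zero]; exact hH0
      obtain ⟨v₀, hv₀⟩ := nonempty_iff_ne_empty.mpr hempty
      rw [mem_filter, hAc, mem_filter, hA, mem_filter] at hv₀
      obtain ⟨⟨⟨-, hg0⟩, hc0⟩, hr0⟩ := hv₀
      have hset : Ac.filter (fun v => redVec d v = r) = C.filter (fun v => DvdVec (ℓ : ℤ) (v - v₀)) := by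
        rw [hAc, hA, filter_filter, filter_filter, ← hc0, ← hr0, hℓ]
        exact filter_dvd_red_red_eq hqpos hg0
      rw [hset, hC]
      have hreal : (∑ v ∈ (latticeCube a S₀).filter (fun v => DvdVec (ℓ : ℤ) (v - v₀)), ((f v : ℝ) : ℂ)) =
          ((swSum X τ m ℓ (coordElt v₀) a S₀ : ℝ) : ℂ) := by
        rw [← sum_filter_lcm_eq_swSum]; push_cast; rfl
      rw [hreal, Complex.norm_real, Real.norm_eq_abs]
      exact hHyp ℓ hℓ1 hℓQ (coordElt v₀) V a S₀ hV hs hcube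
    rw [hsplit']
    calc ‖∑ r ∈ resVecs d, ((w r : ℝ) : ℂ) * ∑ v ∈ Ac.filter (fun v => redVec d v = r), ((f v : ℝ) : ℂ)‖
        ≤ ∑ r ∈ resVecs d, ‖((w r : ℝ) : ℂ) * ∑ v ∈ Ac.filter (fun v => redVec d v = r), ((f v : ℝ) : ℂ)‖ :=
          norm_sum_le _ _
      _ ≤ ∑ _r ∈ resVecs d, H := by
          refine sum_le_sum fun r hr => ?_
          rw [norm_mul, Complex.norm_real, Real.norm_eq_abs]
          calc |w r| * ‖∑ v ∈ Ac.filter (fun v => redVec d v = r), ((f v : ℝ) : ℂ)‖ ≤ 1 * H :=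
                mul_le_mul (hw1 r) (hclass r hr) (norm_nonneg _) zero_le_one
            _ = H := one_mul H
      _ = (d : ℝ) ^ 3 * H := by rw [sum_const, card_resVecs, nsmul_eq_mul]; push_cast; ring
  rw [hsplit]
  calc ‖∑ c ∈ resVecs q, LargeSieve.e ((dot3 b c : ℤ) / (q : ℝ)) *
          ∑ v ∈ A.filter (fun v => redVec q v = c), ((w v * f v : ℝ) : ℂ)‖
      ≤ ∑ c ∈ resVecs q, ‖LargeSieve.e ((dot3 b c : ℤ) / (q : ℝ)) *
          ∑ v ∈ A.filter (fun v => redVec q v = c), ((w v * f v : ℝ) : ℂ)‖ := norm_sum_le _ _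
    _ ≤ ∑ _c ∈ resVecs q, (d : ℝ) ^ 3 * H := by
        refine sum_le_sum fun c hc => ?_
        rw [norm_mul, norm_e, one_mul]
        exact hinner c hc
    _ = (q : ℝ) ^ 3 * ((d : ℝ) ^ 3 * H) := by rw [sum_const, card_resVecs, nsmul_eq_mul]; push_cast; ring

open scoped Classical in
/-- **The small-`q` bound, twisted**: for a lattice cube `C` of side `S₀` satisfying the conditions of (3.14)
(`CubeCond`, `S₀ ≥ L²`) whose points are nonzero with `h.c.f. ≤ M`, `q ≥ 1`, `G ≥ 1` with `qG ≤ Q₁`, a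
`d`-periodic twist `|w| ≤ 1`, and (3.14) up to `d·Q₁`:
`|S(b/q; C; F'(w))| ≤ q³ G · d³C₁Ve^{−c₁√log L} + 9 S₃^{1/3} ∑_{G < g ≤ M} (S₀/g + 1)²`.
[cite: HeathBrownMoroz2004, Proposition 4.2] -/
theorem norm_Sfrac_Fprim_le (hX : 1 < X) (hτ : 0 < τ) (hτ1 : τ ≤ 1) {n : ℕ} {m : Fin (n + 1) → ℕ}
    (hm : CoreAdmissible τ m) {Q₁ C₁ c₁ c₃ c₄ : ℝ} {d : ℕ} (hd : 0 < d)
    (hHyp : Hyp314 X τ m ((d : ℝ) * Q₁) C₁ c₁ c₃ c₄) (hw1 : ∀ b, |w b| ≤ 1)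
    (hwper : ∀ b u, DvdVec (d : ℤ) u → w (b + u) = w b) {V : ℝ} (hV : 0 < V)
    {a : ℝ × ℝ × ℝ} {S₀ : ℝ} (hS : 0 ≤ S₀) (hs : hbL X τ ^ 2 ≤ S₀) (hcube : CubeCond c₃ c₄ V a S₀)
    (hC0 : ∀ v ∈ latticeCube a S₀, v ≠ 0) {M : ℕ} (hM : ∀ v ∈ latticeCube a S₀, hcf3 v ≤ M)
    {q : ℕ} (hq : 1 ≤ q) {G : ℝ} (hG : 1 ≤ G) (hqG : (q : ℝ) * G ≤ Q₁) (b : ℤ × ℤ × ℤ) :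
    ‖Sfrac (Fprim X τ m w) (latticeCube a S₀) q b‖ ≤
      (q : ℝ) ^ 3 * G * ((d : ℝ) ^ 3 * (C₁ * V * Real.exp (-(c₁ * Real.sqrt (Real.log (hbL X τ)))))) +
        9 * (∑ v ∈ latticeCube a S₀, (idealDivisorCount (Ideal.span {coordElt v}) : ℝ) ^ 3) ^ (1 / 3 : ℝ) *
          ∑ g ∈ Ioc ⌊G⌋₊ M, (S₀ / g + 1) ^ 2 := by
  classical
  set C := latticeCube a S₀ with hC
  set H : ℝ := (d : ℝ) ^ 3 * (C₁ * V * Real.exp (-(c₁ * Real.sqrt (Real.log (hbL X τ))))) with hH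
  set S₃ : ℝ := ∑ v ∈ latticeCube a S₀, (idealDivisorCount (Ideal.span {coordElt v}) : ℝ) ^ 3 with hS₃
  have hS₃0 : 0 ≤ S₃ := sum_nonneg fun v _ => by positivity
  have hH0 : 0 ≤ H := by
    have h1 : (1 : ℝ) ≤ (d : ℝ) * Q₁ := by
      have hd1 : (1 : ℝ) ≤ d := by exact_mod_cast hd
      have : (q : ℝ) * G ≥ 1 * 1 := mul_le_mul (by exact_mod_cast hq) hG zero_le_one (by positivity)
      nlinarith
    have := hHyp 1 le_rfl (by simpa using h1) 0 V a S₀ hV hs hcube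
    have h0 := (abs_nonneg _).trans this
    rw [hH]; positivity
  rw [Sfrac_Fprim_eq_sum_moebius hC0 hM q b]
  set Gn : ℕ := ⌊G⌋₊ with hGn
  have hGn1 : 1 ≤ Gn := by rw [hGn]; exact Nat.le_floor (by exact_mod_cast hG)
  rw [← sum_filter_add_sum_filter_not (Icc 1 M) (fun g => g ≤ Gn)]
  refine (norm_add_le _ _).trans (add_le_add ?_ ?_)
  · calc ‖∑ g ∈ (Icc 1 M).filter (fun g => g ≤ Gn), (μ g : ℂ) * Ag X τ m w C q b g‖
        ≤ ∑ g ∈ (Icc 1 M).filter (fun g => g ≤ Gn), ‖(μ g : ℂ) * Ag X τ m w C q b g‖ := norm_sum_le _ _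
      _ ≤ ∑ g ∈ (Icc 1 M).filter (fun g => g ≤ Gn), (q : ℝ) ^ 3 * H := by
          refine sum_le_sum fun g hg => ?_
          rw [mem_filter, mem_Icc] at hg
          have hμ : ‖(μ g : ℂ)‖ ≤ 1 := by
            have := ArithmeticFunction.abs_moebius_le_one (n := g)
            rw [Complex.norm_intCast]; exact_mod_cast this
          have hgq : ((g * q : ℕ) : ℝ) ≤ Q₁ := by
            have hgG : (g : ℝ) ≤ G := by
              have : (g : ℝ) ≤ Gn := by exact_mod_cast hg.2
              exact this.trans (Nat.floor_le (by linarith))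
            calc ((g * q : ℕ) : ℝ) = (q : ℝ) * g := by push_cast; ring
              _ ≤ (q : ℝ) * G := by gcongr
              _ ≤ Q₁ := hqG
          have hA := norm_Ag_le hd hHyp hw1 hwper hV hs hcube hq hg.1.1 hgq b
          rw [norm_mul]
          calc ‖(μ g : ℂ)‖ * ‖Ag X τ m w C q b g‖ ≤ 1 * ((q : ℝ) ^ 3 * H) :=
                mul_le_mul hμ hA (norm_nonneg _) zero_le_one
            _ = (q : ℝ) ^ 3 * H := one_mul _
      _ = #((Icc 1 M).filter (fun g => g ≤ Gn)) * ((q : ℝ) ^ 3 * H) := by rw [sum_const, nsmul_eq_mul]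
      _ ≤ Gn * ((q : ℝ) ^ 3 * H) := by
          gcongr
          have : (Icc 1 M).filter (fun g => g ≤ Gn) ⊆ Icc 1 Gn := by
            intro g hg; rw [mem_filter, mem_Icc] at hg; rw [mem_Icc]; exact ⟨hg.1.1, hg.2⟩
          exact_mod_cast (card_le_card this).trans (by simp)
      _ ≤ G * ((q : ℝ) ^ 3 * H) := by
          gcongr; exact Nat.floor_le (by linarith)
      _ = (q : ℝ) ^ 3 * G * H := by ring
  · calc ‖∑ g ∈ (Icc 1 M).filter (fun g => ¬g ≤ Gn), (μ g : ℂ) * Ag X τ m w C q b g‖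
        ≤ ∑ g ∈ (Icc 1 M).filter (fun g => ¬g ≤ Gn), ‖(μ g : ℂ) * Ag X τ m w C q b g‖ := norm_sum_le _ _
      _ ≤ ∑ g ∈ (Icc 1 M).filter (fun g => ¬g ≤ Gn), 9 * S₃ ^ (1 / 3 : ℝ) * (S₀ / g + 1) ^ 2 := by
          refine sum_le_sum fun g hg => ?_
          rw [mem_filter, mem_Icc] at hg
          have hg1 : 1 ≤ g := hg.1.1
          have hμ : ‖(μ g : ℂ)‖ ≤ 1 := by
            have := ArithmeticFunction.abs_moebius_le_one (n := g)
            rw [Complex.norm_intCast]; exact_mod_cast this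
          have hA : ‖Ag X τ m w C q b g‖ ≤ 9 * ((S₀ / g + 1) ^ 2 * S₃ ^ (1 / 3 : ℝ)) := by
            calc ‖Ag X τ m w C q b g‖
                ≤ ∑ v ∈ C.filter (fun v => DvdVec (g : ℤ) v),
                    ‖((w v * fWeight X τ m (Ideal.span {coordElt v}) : ℝ) : ℂ) *
                      LargeSieve.e ((dot3 b v : ℤ) / (q : ℝ))‖ := norm_sum_le _ _
              _ ≤ ∑ v ∈ C.filter (fun v => DvdVec (g : ℤ) v), 9 * (idealDivisorCount (Ideal.span {coordElt v}) : ℝ) := by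
                  refine sum_le_sum fun v _ => ?_
                  rw [norm_mul, norm_e, mul_one, Complex.norm_real, Real.norm_eq_abs, abs_mul]
                  calc |w v| * |fWeight X τ m (Ideal.span {coordElt v})|
                      ≤ 1 * (9 * (idealDivisorCount (Ideal.span {coordElt v}) : ℝ)) :=
                        mul_le_mul (hw1 v) (abs_fWeight_le hX hτ hτ1 hm _) (abs_nonneg _) zero_le_one
                    _ = _ := one_mul _
              _ = 9 * ∑ v ∈ C.filter (fun v => DvdVec (g : ℤ) v), (idealDivisorCount (Ideal.span {coordElt v}) : ℝ) := by
                  rw [mul_sum]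
              _ ≤ 9 * ((S₀ / g + 1) ^ 2 * S₃ ^ (1 / 3 : ℝ)) := by
                  gcongr; exact sum_filter_dvd_tau_le hg1 a hS
          rw [norm_mul]
          calc ‖(μ g : ℂ)‖ * ‖Ag X τ m w C q b g‖ ≤ 1 * (9 * ((S₀ / g + 1) ^ 2 * S₃ ^ (1 / 3 : ℝ))) :=
                mul_le_mul hμ hA (norm_nonneg _) zero_le_one
            _ = 9 * S₃ ^ (1 / 3 : ℝ) * (S₀ / g + 1) ^ 2 := by ring
      _ = 9 * S₃ ^ (1 / 3 : ℝ) * ∑ g ∈ (Icc 1 M).filter (fun g => ¬g ≤ Gn), (S₀ / g + 1) ^ 2 := by rw [mul_sum]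
      _ ≤ 9 * S₃ ^ (1 / 3 : ℝ) * ∑ g ∈ Ioc Gn M, (S₀ / g + 1) ^ 2 := by
          gcongr
          · intro g hg
            rw [mem_filter, mem_Icc] at hg; rw [mem_Ioc]; omega

end Literature.NumberTheory.Sieve.CubicSieve.Twisted

end
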